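import Literature.Computability.Complexity.FourierTails

/-!
# Stub `stub_influenceTail` (rung R1) of line `Sketch` for the crux `ArithStatLadder.IqThreeNotPPoly`

The truncated Fourier formula for the **total influence** (average sensitivity) of a Boolean
function on the cube `{0,1}ⁿ` (O'Donnell, *Analysis of Boolean Functions*, 2014, §2.3, Prop. 2.24 and
Thm 2.38): with `g = sgn ∘ f ∈ {±1}` and `x^{⊕i} = Function.update x i (!x i)`,

* `Inf_i[f] = #{x : f x ≠ f x^{⊕i}} / 2ⁿ = Σ_{S ∋ i} ĝ(S)²` (`influenceTail_inf_eq`): the function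
  `h = g − g ∘ ⊕i` has `h² = 4·[f x ≠ f x^{⊕i}]` pointwise and `ĥ(S) = 2 [i ∈ S] ĝ(S)` (the shift
  `(g ∘ ⊕i)^(S) = (−1)^{[i∈S]} ĝ(S)`, `influenceTail_coeff_flip`), so Parseval for `h` gives the claim;
* summing over `i` and swapping sums, `I[f] = Σ_S |S| ĝ(S)²`;
* truncating at level `k`: `|S| ĝ(S)² ≤ k ĝ(S)²` when `|S| ≤ k` and `≤ n ĝ(S)²` when `|S| ≥ k + 1`,
  and `Σ_S ĝ(S)² = 1` (Parseval, `g² = 1`), whence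
  `I[f] ≤ k + n · W^{≥ k+1}[g]` (`stub_influenceTail`, the registered statement, verbatim).

Everything is a finite sum over the cube; the only inputs are `cubeFourierCoeff`, Parseval
(`sum_cubeFourierCoeff_sq`) and linearity (`cubeFourierCoeff_sub`) of
`Literature/Computability/Complexity/BooleanFourier.lean`, `FourierTails.lean` (`tailWeight`).
The flip/shift helpers are adapted from §S4a of
`Summits/PneNP/PneNP/Cruxes/SliceACZero/DrefuteG3RussoWindowLadderComplete.lean` (not importable
here), restated for `Function.update x i (!x i)` literally so that the registered signature
elaborates unchanged.
-/

set_option linter.dupNamespace false -- D-0017: single-problem summit ⇒ `QuantumAdvantage.QuantumAdvantage` by design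

noncomputable section

namespace Summit.QuantumAdvantage.QuantumAdvantage.Theorems.IqThreeNotPPoly

open scoped Classical BigOperators
open Finset
open Literature.Computability.Complexity
open Literature.Computability.Complexity.LowDegree (cubeFourierCoeff tailWeight sum_cubeFourierCoeff_sq)
open Literature.Probability.RandomGraphs.LowDegree (sgn sgn_true sgn_false walsh)

/-- Flipping bit `i` twice is the identity: `(x^{⊕i})^{⊕i} = x`. -/
theorem influenceTail_flip_flip {n : ℕ} (i : Fin n) (x : Fin n → Bool) :
    Function.update (Function.update x i (!x i)) i (!Function.update x i (!x i) i) = x := by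
  rw [Function.update_self, Bool.not_not, Function.update_idem, Function.update_eq_self]

-- adapted from `S4a.walsh_flipAt` of
-- `Summits/PneNP/PneNP/Cruxes/SliceACZero/DrefuteG3RussoWindowLadderComplete.lean`
/-- A character at the flipped point: `χ_S(x^{⊕i}) = (−1)^{[i∈S]} χ_S(x)` (split off the factor
`j = i` of `∏_{j∈S} sgn (x j)` when `i ∈ S`; the other factors are unchanged). -/
theorem influenceTail_walsh_flip {n : ℕ} (S : Finset (Fin n)) (i : Fin n) (x : Fin n → Bool) :
    walsh S (Function.update x i (!x i)) = (if i ∈ S then -1 else 1) * walsh S x := by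
  unfold Literature.Probability.RandomGraphs.LowDegree.walsh
  -- `sgn (¬b) = −sgn b` (this is `sgn_not` of `HuangMatrix.lean` / `ACForm.sgn_not`; two lines,
  -- not worth either import)
  have hnot : sgn (!x i) = -sgn (x i) := by cases x i <;> simp
  by_cases hi : i ∈ S
  · rw [if_pos hi, ← Finset.mul_prod_erase S (fun j => sgn (Function.update x i (!x i) j)) hi,
      ← Finset.mul_prod_erase S (fun j => sgn (x j)) hi, Function.update_self, hnot]
    have : ∏ j ∈ S.erase i, sgn (Function.update x i (!x i) j) = ∏ j ∈ S.erase i, sgn (x j) :=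
      Finset.prod_congr rfl fun j hj => by rw [Function.update_of_ne (Finset.ne_of_mem_erase hj)]
    rw [this]; ring
  · rw [if_neg hi, one_mul]
    exact Finset.prod_congr rfl fun j hj => by
      rw [Function.update_of_ne (by rintro rfl; exact hi hj)]

-- adapted from `S4a.cubeFourierCoeff_flipAt` (same PneNP file as above)
/-- **Coefficients of the flipped function**: `(g ∘ ⊕i)^(S) = (−1)^{[i∈S]} ĝ(S)` (O'Donnell 2014,
§1.2; reindex the defining sum along the involution `x ↦ x^{⊕i}`). -/
theorem influenceTail_coeff_flip {n : ℕ} (g : (Fin n → Bool) → ℝ) (i : Fin n) (S : Finset (Fin n)) :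
    cubeFourierCoeff (fun x => g (Function.update x i (!x i))) S =
      (if i ∈ S then -1 else 1) * cubeFourierCoeff g S := by
  unfold LowDegree.cubeFourierCoeff
  rw [mul_div_assoc', Finset.mul_sum]
  congr 1
  have hinv : Function.Involutive (fun x : Fin n → Bool => Function.update x i (!x i)) :=
    influenceTail_flip_flip i
  refine Fintype.sum_bijective _ hinv.bijective _ _ fun x => ?_
  dsimp only
  rw [influenceTail_walsh_flip]
  split_ifs <;> ring

-- adapted from `S4a.sum_sq_coeff_mem` (same PneNP file as above)
/-- **`Inf_i` in Fourier terms** (O'Donnell 2014, Prop. 2.24, `{0,1}ⁿ` form): for `g = sgn ∘ f`,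
`#{x : f x ≠ f x^{⊕i}} / 2ⁿ = Σ_{S ∋ i} ĝ(S)²`. -/
theorem influenceTail_inf_eq {n : ℕ} (f : (Fin n → Bool) → Bool) (i : Fin n) :
    ((univ.filter (fun x : Fin n → Bool => f x ≠ f (Function.update x i (!x i)))).card : ℝ) / 2 ^ n =
      ∑ S : Finset (Fin n), if i ∈ S then cubeFourierCoeff (fun x => sgn (f x)) S ^ 2 else 0 := by
  -- `h = g - g ∘ ⊕i` has `h² = 4 · [f x ≠ f x^{⊕i}]` pointwise ...
  have hsum : ∑ x : Fin n → Bool, (sgn (f x) - sgn (f (Function.update x i (!x i)))) ^ 2 =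
      4 * ((univ.filter (fun x : Fin n → Bool => f x ≠ f (Function.update x i (!x i)))).card : ℝ) := by
    rw [← Finset.sum_boole, Finset.mul_sum]
    refine Finset.sum_congr rfl fun x _ => ?_
    cases f x <;> cases f (Function.update x i (!x i)) <;> norm_num
  -- ... and coefficients `ĥ(S) = 2 [i ∈ S] ĝ(S)`
  have hcoef : ∀ S : Finset (Fin n),
      cubeFourierCoeff (fun x => sgn (f x) - sgn (f (Function.update x i (!x i)))) S =
        if i ∈ S then 2 * cubeFourierCoeff (fun x => sgn (f x)) S else 0 := by
    intro S
    rw [LowDegree.cubeFourierCoeff_sub (fun x => sgn (f x))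
        (fun x => sgn (f (Function.update x i (!x i)))),
      influenceTail_coeff_flip (fun x => sgn (f x))]
    split_ifs <;> ring
  -- Parseval for `h`
  have hpar := sum_cubeFourierCoeff_sq (fun x => sgn (f x) - sgn (f (Function.update x i (!x i))))
  rw [hsum] at hpar
  have h4 : ∑ S : Finset (Fin n),
      cubeFourierCoeff (fun x => sgn (f x) - sgn (f (Function.update x i (!x i)))) S ^ 2 =
        4 * ∑ S : Finset (Fin n), if i ∈ S then cubeFourierCoeff (fun x => sgn (f x)) S ^ 2 else 0 := by
    rw [Finset.mul_sum]
    refine Finset.sum_congr rfl fun S _ => ?_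
    rw [hcoef]
    split_ifs <;> ring
  rw [h4] at hpar
  -- `4 · Σ = 4 · card / 2ⁿ`
  calc ((univ.filter (fun x : Fin n → Bool => f x ≠ f (Function.update x i (!x i)))).card : ℝ) / 2 ^ n
      = (4 * ((univ.filter (fun x : Fin n → Bool =>
          f x ≠ f (Function.update x i (!x i)))).card : ℝ) / 2 ^ n) / 4 := by ring
    _ = _ := by rw [← hpar]; ring

/-- **Total influence in Fourier terms** (O'Donnell 2014, Thm 2.38): `I[f] = Σ_S |S| ĝ(S)²`. -/
theorem influenceTail_total_eq {n : ℕ} (f : (Fin n → Bool) → Bool) :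
    (∑ i : Fin n, ((Finset.univ.filter
        (fun x : Fin n → Bool => f x ≠ f (Function.update x i (!x i)))).card : ℝ)) / 2 ^ n =
      ∑ S : Finset (Fin n), (S.card : ℝ) * cubeFourierCoeff (fun x => sgn (f x)) S ^ 2 := by
  rw [Finset.sum_div]
  simp_rw [influenceTail_inf_eq]
  rw [Finset.sum_comm]
  refine Finset.sum_congr rfl fun S _ => ?_
  rw [Fintype.sum_ite_mem, Finset.sum_const, nsmul_eq_mul]

/-- Parseval for a `{±1}`-valued function: `Σ_S ĝ(S)² = 1` for `g = sgn ∘ f`. -/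
theorem influenceTail_sum_sq_eq_one {n : ℕ} (f : (Fin n → Bool) → Bool) :
    ∑ S : Finset (Fin n), cubeFourierCoeff (fun x => sgn (f x)) S ^ 2 = 1 := by
  have hsq : ∀ x : Fin n → Bool, sgn (f x) ^ 2 = 1 := fun x => by cases f x <;> norm_num
  rw [sum_cubeFourierCoeff_sq]
  simp only [hsq, Finset.sum_const, Finset.card_univ, Fintype.card_fun,
    Fintype.card_bool, Fintype.card_fin, nsmul_eq_mul, mul_one, Nat.cast_pow, Nat.cast_ofNat]
  rw [div_self (by positivity)]

/-- **RUNG STUB R1 · `stub_influenceTail`** (O'Donnell 2014, §2.3–2.4): the total influence of a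
Boolean `f` on `{0,1}ⁿ`, truncated at level `k`:
`I[f] = Σ_S |S| ĝ(S)² ≤ k · Σ_{|S| ≤ k} ĝ(S)² + n · Σ_{|S| ≥ k+1} ĝ(S)² ≤ k + n · W^{≥k+1}[g]`
for `g = sgn ∘ f` (Parseval `Σ_S ĝ(S)² = 1`). -/
theorem stub_influenceTail :
    ∀ (n k : ℕ) (f : (Fin n → Bool) → Bool),
      (∑ i : Fin n, ((Finset.univ.filter
          (fun x : Fin n → Bool => f x ≠ f (Function.update x i (!x i)))).card : ℝ)) / 2 ^ n
        ≤ k + n * LowDegree.tailWeight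
          (fun x => Literature.Probability.RandomGraphs.LowDegree.sgn (f x)) (k + 1) := by
  intro n k f
  rw [influenceTail_total_eq]
  have hG0 : ∀ S : Finset (Fin n), 0 ≤ cubeFourierCoeff (fun x => sgn (f x)) S ^ 2 :=
    fun S => sq_nonneg _
  -- split the level sum at `k + 1 ≤ |S|`
  rw [← Finset.sum_filter_add_sum_filter_not (univ : Finset (Finset (Fin n)))
    (fun S : Finset (Fin n) => k + 1 ≤ S.card)]
  -- high part: `|S| ≤ n`
  have hhigh : ∑ S ∈ univ.filter (fun S : Finset (Fin n) => k + 1 ≤ S.card),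
      (S.card : ℝ) * cubeFourierCoeff (fun x => sgn (f x)) S ^ 2 ≤
        n * tailWeight (fun x => sgn (f x)) (k + 1) := by
    unfold LowDegree.tailWeight
    rw [Finset.mul_sum]
    refine Finset.sum_le_sum fun S _ => mul_le_mul_of_nonneg_right ?_ (hG0 S)
    have h := S.card_le_univ
    rw [Fintype.card_fin] at h
    exact_mod_cast h
  -- low part: `|S| ≤ k`, then Parseval
  have hlow : ∑ S ∈ univ.filter (fun S : Finset (Fin n) => ¬ (k + 1 ≤ S.card)),
      (S.card : ℝ) * cubeFourierCoeff (fun x => sgn (f x)) S ^ 2 ≤ k := by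
    calc ∑ S ∈ univ.filter (fun S : Finset (Fin n) => ¬ (k + 1 ≤ S.card)),
          (S.card : ℝ) * cubeFourierCoeff (fun x => sgn (f x)) S ^ 2
        ≤ ∑ S ∈ univ.filter (fun S : Finset (Fin n) => ¬ (k + 1 ≤ S.card)),
            (k : ℝ) * cubeFourierCoeff (fun x => sgn (f x)) S ^ 2 := by
          refine Finset.sum_le_sum fun S hS => mul_le_mul_of_nonneg_right ?_ (hG0 S)
          simp only [Finset.mem_filter, Finset.mem_univ, true_and, not_le] at hS
          exact_mod_cast Nat.lt_succ_iff.mp hS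
      _ = k * ∑ S ∈ univ.filter (fun S : Finset (Fin n) => ¬ (k + 1 ≤ S.card)),
            cubeFourierCoeff (fun x => sgn (f x)) S ^ 2 := by rw [Finset.mul_sum]
      _ ≤ k * ∑ S : Finset (Fin n), cubeFourierCoeff (fun x => sgn (f x)) S ^ 2 :=
          mul_le_mul_of_nonneg_left (Finset.sum_le_univ_sum_of_nonneg hG0) (Nat.cast_nonneg k)
      _ = k := by rw [influenceTail_sum_sq_eq_one, mul_one]
  linarith

end Summit.QuantumAdvantage.QuantumAdvantage.Theorems.IqThreeNotPPoly

end
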